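import Literature.NumberTheory.Automorphic.ArchPlaceCasimirReal
import HarnessLib

/-!
# The holomorphic and antiholomorphic Casimir operators of a complex place commute with `GL_n(K_∞)` on the Gårding space

Topic `NumberTheory/Automorphic`; namespace `Literature.NumberTheory.Automorphic`. Definitions with
bodies and theorems (no named fact); sequel of `ArchPlaceCasimirReal`. For a strongly continuous
representation `τ` of `G_∞ = GL_n(K_∞)` and a COMPLEX place `w` of `K`, write `c = c_w = (0, Pi.single w 1)`
for the idempotent of the factor `K_w = ℂ` of `K_∞ = mixedSpace K` and `ic = (0, Pi.single w i)`. The real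
Lie algebra `𝔤𝔩_n(K_w) = 𝔤𝔩_n(ℂ)` has complexification `𝔤𝔩_n(ℂ) ⊕ 𝔤𝔩_n(ℂ)`; on Gårding vectors the two
factors act through the **holomorphic and antiholomorphic derivatives**

  `τ^{hol}(E_{ij}) u = τ(E_{ij} ⊗ c) u - i τ(E_{ij} ⊗ ic) u`,  `τ^{anti}(E_{ij}) u = τ(E_{ij} ⊗ c) u + i τ(E_{ij} ⊗ ic) u`

(`archDerivHol`, `archDerivAnti`; twice the usual `½(X - iJX)`, `½(X + iJX)`), and the two Casimir
operators of the place are `C^{hol}_w = Σ_{ij} τ^{hol}(E_{ij}) τ^{hol}(E_{ji})`,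
`C^{anti}_w = Σ_{ij} τ^{anti}(E_{ij}) τ^{anti}(E_{ji})` (Knapp (1986), Ch. VIII §3; Jacquet–Shalika
(1981), p. 523: "The proof for `r = 2`, `F = ℂ` is similar"). We prove:

* `apply_toArch_archDerivHol` / `apply_toArch_archDerivAnti` — the transformation laws
  `τ(g) τ^{hol}(E_{ij}) τ(g)⁻¹ = Σ_{kl} (g_{ki})_w (g⁻¹_{jl})_w τ^{hol}(E_{kl})` (complex coefficients:
  `τ^{hol}` is complex linear in the direction) and the same with conjugate coefficients for `τ^{anti}`
  (from `y c y' = Re(y_w y'_w) c + Im(y_w y'_w) ic`, `y ic y' = -Im(…) c + Re(…) ic`);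
* `apply_toArch_placeCasimirHol` / `apply_toArch_placeCasimirAnti` — **both Casimir operators commute
  with every `τ(g)`** on Gårding vectors (the abstract bookkeeping
  `sum_sum_comp_comp_eq_of_transform` of `ArchPlaceCasimirReal` with complex `a, b`);
* `inner_archDerivHol_left`, `inner_placeCasimirHol_left` — **formal adjoints**:
  `⟪τ^{hol}(X) v, u⟫ = -⟪v, τ^{anti}(X) u⟫` and `⟪C^{hol}_w v, u⟫ = ⟪v, C^{anti}_w u⟫` for Gårding `v, u`
  and unitary `τ` (and symmetrically).

With Segal's lemma these make `C^{hol}_w`, `C^{anti}_w` scalars on the Gårding space of an irreducible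
unitary `τ`, on the route to the named fact
`Literature.NumberTheory.Automorphic.JacquetShalika1981_archKirillovNorm_le`.

## References

* A. W. Knapp, *Representation Theory of Semisimple Groups*, Princeton (1986), Ch. VIII §3
  [Knapp1986].
* H. Jacquet, J. A. Shalika, *On Euler products and the classification of automorphic
  representations I*, Amer. J. Math. 103 (1981), §3, proof of Prop. (3.8), p. 523 [JacquetShalikaAJM1981].
-/

noncomputable section

open MeasureTheory Measure NumberField NumberField.mixedEmbedding NumberField.InfinitePlace IsDedekindDomain Set Filter
open Complex (I)
open scoped MatrixGroups ENNReal NNReal Classical Topology InnerProductSpace ComplexConjugate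

namespace Literature.NumberTheory.Automorphic

variable {n : ℕ} {K : Type} [Field K] [NumberField K]

attribute [local instance] glInfBorel borelSpace_glInf locallyCompactSpace_glInf secondCountableTopology_glInf

-- as in `ArchGardingWhittaker`
set_option backward.isDefEq.respectTransparency false

/-! ### 1. The idempotent `c_w` and `i c_w` of a complex place -/

section ComplexPlace

omit [NumberField K] in
/-- `y · c_w · y' = Re(y_w y'_w) · c_w + Im(y_w y'_w) · (i c_w)` in `K_∞` for a complex place `w`. [folklore] -/
theorem mul_complexIdem_mul (w : {w : InfinitePlace K // IsComplex w}) (y y' : mixedSpace K) :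
    y * ((0, Pi.single w 1) : mixedSpace K) * y' =
      (y.2 w * y'.2 w).re • ((0, Pi.single w 1) : mixedSpace K) + (y.2 w * y'.2 w).im • ((0, Pi.single w I) : mixedSpace K) := by
  refine Prod.ext (funext fun w' => ?_) (funext fun w' => ?_)
  · simp
  · simp only [Prod.snd_mul, Pi.mul_apply, Prod.snd_add, Pi.add_apply, Prod.smul_snd, Pi.smul_apply,
      Complex.real_smul]
    by_cases h : w' = w
    · subst h
      simp only [Pi.single_eq_same, mul_one]
      exact (Complex.re_add_im _).symm
    · simp [Pi.single_eq_of_ne h]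

omit [NumberField K] in
/-- `y · (i c_w) · y' = -Im(y_w y'_w) · c_w + Re(y_w y'_w) · (i c_w)` in `K_∞` for a complex place `w`. [folklore] -/
theorem mul_complexIdemI_mul (w : {w : InfinitePlace K // IsComplex w}) (y y' : mixedSpace K) :
    y * ((0, Pi.single w I) : mixedSpace K) * y' =
      (-(y.2 w * y'.2 w).im) • ((0, Pi.single w 1) : mixedSpace K) + (y.2 w * y'.2 w).re • ((0, Pi.single w I) : mixedSpace K) := by
  refine Prod.ext (funext fun w' => ?_) (funext fun w' => ?_)
  · simp
  · simp only [Prod.snd_mul, Pi.mul_apply, Prod.snd_add, Pi.add_apply, Prod.smul_snd, Pi.smul_apply,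
      Complex.real_smul]
    by_cases h : w' = w
    · subst h
      simp only [Pi.single_eq_same, mul_one]
      have e := Complex.re_add_im (y.2 w' * y'.2 w')
      calc y.2 w' * I * y'.2 w' = I * (y.2 w' * y'.2 w') := by ring
        _ = I * (((y.2 w' * y'.2 w').re : ℂ) + ((y.2 w' * y'.2 w').im : ℂ) * I) := by rw [e]
        _ = ((-(y.2 w' * y'.2 w').im : ℝ) : ℂ) + (((y.2 w' * y'.2 w').re : ℝ) : ℂ) * I := by
            rw [Complex.ofReal_neg]; ring_nf; rw [Complex.I_sq]; ring
    · simp [Pi.single_eq_of_ne h]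

omit [NumberField K] in
/-- The `w`-components (complex place) of `g g⁻¹ = 1`: `Σ_i (g_{ki})_w (g⁻¹_{il})_w = δ_{kl}`. [folklore] -/
theorem sum_snd_mul_snd_inv_eq (w : {w : InfinitePlace K // IsComplex w}) (g : GL (Fin n) (mixedSpace K)) (k l : Fin n) :
    ∑ i, (g.val k i).2 w * ((g⁻¹).val i l).2 w = if k = l then 1 else 0 := by
  have h1 : (g.val * (g⁻¹).val) k l = (1 : Matrix (Fin n) (Fin n) (mixedSpace K)) k l := by
    rw [← Units.val_mul, mul_inv_cancel, Units.val_one]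
  rw [Matrix.mul_apply] at h1
  have h2 := congrArg (fun y : mixedSpace K => y.2 w) h1
  simp only [Prod.snd_sum, Finset.sum_apply, Prod.snd_mul, Pi.mul_apply] at h2
  rw [h2, Matrix.one_apply]
  by_cases hkl : k = l
  · subst hkl; simp
  · rw [if_neg hkl, if_neg hkl]; simp

omit [NumberField K] in
/-- The conjugate form: `Σ_i conj((g_{ki})_w) conj((g⁻¹_{il})_w) = δ_{kl}`. [folklore] -/
theorem sum_conj_snd_mul_conj_snd_inv_eq (w : {w : InfinitePlace K // IsComplex w}) (g : GL (Fin n) (mixedSpace K))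
    (k l : Fin n) :
    ∑ i, conj ((g.val k i).2 w) * conj (((g⁻¹).val i l).2 w) = if k = l then 1 else 0 := by
  have h := congrArg conj (sum_snd_mul_snd_inv_eq w g k l)
  rw [_root_.map_sum] at h
  simp only [map_mul] at h
  rw [h]
  by_cases hkl : k = l
  · rw [if_pos hkl, map_one]
  · rw [if_neg hkl, map_zero]

variable {hcpt : isCompact_glFiniteIntegralLevel n K}
  {E : Type*} [NormedAddCommGroup E] [NormedSpace ℂ E] [CompleteSpace E]

variable (hcpt) in
/-- **The holomorphic derivative** along `E_{ij}` at a complex place `w`: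
`τ^{hol}(E_{ij}) u = τ(E_{ij} ⊗ c_w) u - i τ(E_{ij} ⊗ i c_w) u` (twice the `(1,0)`-part of the real
derivative; Knapp (1986), Ch. VIII §3, complexified Lie algebra of a complex group).
[cite: Knapp1986, Ch. VIII §3] -/
def archDerivHol (τ : ContRepresentation ℂ (AutomorphyDatum.gl n K hcpt).arch.carrier E)
    (w : {w : InfinitePlace K // IsComplex w}) (i j : Fin n) (u : E) : E :=
  archDerivE hcpt τ (Matrix.single i j ((0, Pi.single w 1) : mixedSpace K)) u -
    I • archDerivE hcpt τ (Matrix.single i j ((0, Pi.single w I) : mixedSpace K)) u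

variable (hcpt) in
/-- **The antiholomorphic derivative** along `E_{ij}` at a complex place `w`:
`τ^{anti}(E_{ij}) u = τ(E_{ij} ⊗ c_w) u + i τ(E_{ij} ⊗ i c_w) u`. [cite: Knapp1986, Ch. VIII §3] -/
def archDerivAnti (τ : ContRepresentation ℂ (AutomorphyDatum.gl n K hcpt).arch.carrier E)
    (w : {w : InfinitePlace K // IsComplex w}) (i j : Fin n) (u : E) : E :=
  archDerivE hcpt τ (Matrix.single i j ((0, Pi.single w 1) : mixedSpace K)) u +
    I • archDerivE hcpt τ (Matrix.single i j ((0, Pi.single w I) : mixedSpace K)) u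

variable {τ : ContRepresentation ℂ (AutomorphyDatum.gl n K hcpt).arch.carrier E}

/-- `τ^{hol}(E_{ij})` preserves the Gårding space. [folklore] -/
theorem archDerivHol_mem (hτ : τ.IsStronglyContinuous) (w : {w : InfinitePlace K // IsComplex w}) (i j : Fin n)
    {u : E} (hu : u ∈ archGardingSpace hcpt τ) : archDerivHol hcpt τ w i j u ∈ archGardingSpace hcpt τ :=
  Submodule.sub_mem _ (archDerivE_mem_archGardingSpace hτ _ hu)
    (Submodule.smul_mem _ _ (archDerivE_mem_archGardingSpace hτ _ hu))

/-- `τ^{anti}(E_{ij})` preserves the Gårding space. [folklore] -/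
theorem archDerivAnti_mem (hτ : τ.IsStronglyContinuous) (w : {w : InfinitePlace K // IsComplex w}) (i j : Fin n)
    {u : E} (hu : u ∈ archGardingSpace hcpt τ) : archDerivAnti hcpt τ w i j u ∈ archGardingSpace hcpt τ :=
  Submodule.add_mem _ (archDerivE_mem_archGardingSpace hτ _ hu)
    (Submodule.smul_mem _ _ (archDerivE_mem_archGardingSpace hτ _ hu))

/-- Additivity of `τ(X)` on Gårding vectors (one-letter word). [folklore] -/
theorem archDerivE_add_vec (hτ : τ.IsStronglyContinuous) (X : Matrix (Fin n) (Fin n) (mixedSpace K))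
    {u u' : E} (hu : u ∈ archGardingSpace hcpt τ) (hu' : u' ∈ archGardingSpace hcpt τ) :
    archDerivE hcpt τ X (u + u') = archDerivE hcpt τ X u + archDerivE hcpt τ X u' := by
  have h := archWordDerivE_add hτ hu hu' [X]
  simpa only [archWordDerivE_cons, archWordDerivE_nil] using h

/-- Homogeneity of `τ(X)` on Gårding vectors (one-letter word). [folklore] -/
theorem archDerivE_smul_vec (hτ : τ.IsStronglyContinuous) (X : Matrix (Fin n) (Fin n) (mixedSpace K)) (a : ℂ)
    {u : E} (hu : u ∈ archGardingSpace hcpt τ) :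
    archDerivE hcpt τ X (a • u) = a • archDerivE hcpt τ X u := by
  have h := archWordDerivE_smul hτ a hu [X]
  simpa only [archWordDerivE_cons, archWordDerivE_nil] using h

/-- `τ^{hol}(E_{ij})` is additive on Gårding vectors. [folklore] -/
theorem archDerivHol_add (hτ : τ.IsStronglyContinuous) (w : {w : InfinitePlace K // IsComplex w}) (i j : Fin n)
    {u u' : E} (hu : u ∈ archGardingSpace hcpt τ) (hu' : u' ∈ archGardingSpace hcpt τ) :
    archDerivHol hcpt τ w i j (u + u') = archDerivHol hcpt τ w i j u + archDerivHol hcpt τ w i j u' := by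
  unfold archDerivHol
  rw [archDerivE_add_vec hτ _ hu hu', archDerivE_add_vec hτ _ hu hu', smul_add]
  abel

/-- `τ^{hol}(E_{ij})` is homogeneous on Gårding vectors. [folklore] -/
theorem archDerivHol_smul (hτ : τ.IsStronglyContinuous) (w : {w : InfinitePlace K // IsComplex w}) (i j : Fin n)
    (a : ℂ) {u : E} (hu : u ∈ archGardingSpace hcpt τ) :
    archDerivHol hcpt τ w i j (a • u) = a • archDerivHol hcpt τ w i j u := by
  unfold archDerivHol
  rw [archDerivE_smul_vec hτ _ a hu, archDerivE_smul_vec hτ _ a hu, smul_sub, smul_comm]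

/-- `τ^{anti}(E_{ij})` is additive on Gårding vectors. [folklore] -/
theorem archDerivAnti_add (hτ : τ.IsStronglyContinuous) (w : {w : InfinitePlace K // IsComplex w}) (i j : Fin n)
    {u u' : E} (hu : u ∈ archGardingSpace hcpt τ) (hu' : u' ∈ archGardingSpace hcpt τ) :
    archDerivAnti hcpt τ w i j (u + u') = archDerivAnti hcpt τ w i j u + archDerivAnti hcpt τ w i j u' := by
  unfold archDerivAnti
  rw [archDerivE_add_vec hτ _ hu hu', archDerivE_add_vec hτ _ hu hu', smul_add]
  abel

/-- `τ^{anti}(E_{ij})` is homogeneous on Gårding vectors. [folklore] -/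
theorem archDerivAnti_smul (hτ : τ.IsStronglyContinuous) (w : {w : InfinitePlace K // IsComplex w}) (i j : Fin n)
    (a : ℂ) {u : E} (hu : u ∈ archGardingSpace hcpt τ) :
    archDerivAnti hcpt τ w i j (a • u) = a • archDerivAnti hcpt τ w i j u := by
  unfold archDerivAnti
  rw [archDerivE_smul_vec hτ _ a hu, archDerivE_smul_vec hτ _ a hu, smul_add, smul_comm]

/-! ### 2. Transformation laws under `Ad(g)` -/

omit [NumberField K] in
/-- Conjugates of `E_{ij} ⊗ c_w`: `g (E_{ij} ⊗ c) g⁻¹ = Σ_{kl} (Re z_{kl} · E_{kl} ⊗ c + Im z_{kl} · E_{kl} ⊗ ic)`,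
`z_{kl} = (g_{ki})_w (g⁻¹_{jl})_w`. [folklore] -/
theorem conj_single_complexIdem (w : {w : InfinitePlace K // IsComplex w}) (g : GL (Fin n) (mixedSpace K)) (i j : Fin n) :
    g.val * Matrix.single i j ((0, Pi.single w 1) : mixedSpace K) * (g⁻¹).val =
      ∑ k, ∑ l, (((g.val k i).2 w * ((g⁻¹).val j l).2 w).re • Matrix.single k l ((0, Pi.single w 1) : mixedSpace K) +
        ((g.val k i).2 w * ((g⁻¹).val j l).2 w).im • Matrix.single k l ((0, Pi.single w I) : mixedSpace K)) := by
  rw [mul_single_mul_eq_sum]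
  refine Finset.sum_congr rfl fun k _ => Finset.sum_congr rfl fun l _ => ?_
  rw [mul_complexIdem_mul w, Matrix.smul_single, Matrix.smul_single, ← Matrix.single_add]

omit [NumberField K] in
/-- Conjugates of `E_{ij} ⊗ i c_w`: `g (E_{ij} ⊗ ic) g⁻¹ = Σ_{kl} (-Im z_{kl} · E_{kl} ⊗ c + Re z_{kl} · E_{kl} ⊗ ic)`.
[folklore] -/
theorem conj_single_complexIdemI (w : {w : InfinitePlace K // IsComplex w}) (g : GL (Fin n) (mixedSpace K)) (i j : Fin n) :
    g.val * Matrix.single i j ((0, Pi.single w I) : mixedSpace K) * (g⁻¹).val =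
      ∑ k, ∑ l, ((-((g.val k i).2 w * ((g⁻¹).val j l).2 w).im) • Matrix.single k l ((0, Pi.single w 1) : mixedSpace K) +
        ((g.val k i).2 w * ((g⁻¹).val j l).2 w).re • Matrix.single k l ((0, Pi.single w I) : mixedSpace K)) := by
  rw [mul_single_mul_eq_sum]
  refine Finset.sum_congr rfl fun k _ => Finset.sum_congr rfl fun l _ => ?_
  rw [mul_complexIdemI_mul w, Matrix.smul_single, Matrix.smul_single, ← Matrix.single_add]

/-- **Transformation law of the holomorphic derivatives**:
`τ(g) τ^{hol}(E_{ij}) u = Σ_{kl} (g_{ki})_w (g⁻¹_{jl})_w · τ^{hol}(E_{kl}) (τ(g) u)` for Gårding `u`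
(`τ^{hol}` is complex linear in the direction). [cite: Knapp1986, Ch. VIII §3] -/
theorem apply_toArch_archDerivHol (hτ : τ.IsStronglyContinuous) (w : {w : InfinitePlace K // IsComplex w})
    (g : GL (Fin n) (mixedSpace K)) (i j : Fin n) {u : E} (hu : u ∈ archGardingSpace hcpt τ) :
    τ (toArch hcpt g) (archDerivHol hcpt τ w i j u) =
      ∑ k, ∑ l, ((g.val k i).2 w * ((g⁻¹).val j l).2 w) • archDerivHol hcpt τ w k l (τ (toArch hcpt g) u) := by
  have hgu := apply_mem_archGardingSpace hτ (toArch hcpt g) hu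
  unfold archDerivHol
  rw [map_sub, map_smul, apply_toArch_archDerivE hτ hu g, apply_toArch_archDerivE hτ hu g]
  change archDerivE hcpt τ (g.val * Matrix.single i j ((0, Pi.single w 1) : mixedSpace K) * (g⁻¹).val) (τ (toArch hcpt g) u) -
      I • archDerivE hcpt τ (g.val * Matrix.single i j ((0, Pi.single w I) : mixedSpace K) * (g⁻¹).val) (τ (toArch hcpt g) u) = _
  rw [conj_single_complexIdem w g i j, conj_single_complexIdemI w g i j, archDerivE_sum_dir hτ hgu, archDerivE_sum_dir hτ hgu,
    Finset.smul_sum, ← Finset.sum_sub_distrib]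
  refine Finset.sum_congr rfl fun k _ => ?_
  rw [archDerivE_sum_dir hτ hgu, archDerivE_sum_dir hτ hgu, Finset.smul_sum, ← Finset.sum_sub_distrib]
  refine Finset.sum_congr rfl fun l _ => ?_
  set z : ℂ := (g.val k i).2 w * ((g⁻¹).val j l).2 w with hz
  rw [archDerivE_add_dir hτ hgu, archDerivE_add_dir hτ hgu, archDerivE_smul_dir hτ hgu, archDerivE_smul_dir hτ hgu,
    archDerivE_smul_dir hτ hgu, archDerivE_smul_dir hτ hgu]
  set Dc := archDerivE hcpt τ (Matrix.single k l ((0, Pi.single w 1) : mixedSpace K)) (τ (toArch hcpt g) u) with hDc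
  set Dic := archDerivE hcpt τ (Matrix.single k l ((0, Pi.single w I) : mixedSpace K)) (τ (toArch hcpt g) u) with hDic
  have h1 : ((z.re : ℂ) + I * (z.im : ℂ)) = z := by
    apply Complex.ext <;> simp
  have h2 : ((z.im : ℂ) - I * (z.re : ℂ)) = -(z * I) := by
    apply Complex.ext <;> simp
  have hL : ((z.re : ℂ) • Dc + (z.im : ℂ) • Dic) - I • (((-z.im : ℝ) : ℂ) • Dc + (z.re : ℂ) • Dic) =
      ((z.re : ℂ) + I * (z.im : ℂ)) • Dc + ((z.im : ℂ) - I * (z.re : ℂ)) • Dic := by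
    rw [Complex.ofReal_neg]
    module
  rw [hL, h1, h2]
  module

/-- **Transformation law of the antiholomorphic derivatives** (conjugate coefficients).
[cite: Knapp1986, Ch. VIII §3] -/
theorem apply_toArch_archDerivAnti (hτ : τ.IsStronglyContinuous) (w : {w : InfinitePlace K // IsComplex w})
    (g : GL (Fin n) (mixedSpace K)) (i j : Fin n) {u : E} (hu : u ∈ archGardingSpace hcpt τ) :
    τ (toArch hcpt g) (archDerivAnti hcpt τ w i j u) =
      ∑ k, ∑ l, (conj ((g.val k i).2 w) * conj (((g⁻¹).val j l).2 w)) • archDerivAnti hcpt τ w k l (τ (toArch hcpt g) u) := by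
  have hgu := apply_mem_archGardingSpace hτ (toArch hcpt g) hu
  unfold archDerivAnti
  rw [map_add, map_smul, apply_toArch_archDerivE hτ hu g, apply_toArch_archDerivE hτ hu g]
  change archDerivE hcpt τ (g.val * Matrix.single i j ((0, Pi.single w 1) : mixedSpace K) * (g⁻¹).val) (τ (toArch hcpt g) u) +
      I • archDerivE hcpt τ (g.val * Matrix.single i j ((0, Pi.single w I) : mixedSpace K) * (g⁻¹).val) (τ (toArch hcpt g) u) = _
  rw [conj_single_complexIdem w g i j, conj_single_complexIdemI w g i j, archDerivE_sum_dir hτ hgu, archDerivE_sum_dir hτ hgu,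
    Finset.smul_sum, ← Finset.sum_add_distrib]
  refine Finset.sum_congr rfl fun k _ => ?_
  rw [archDerivE_sum_dir hτ hgu, archDerivE_sum_dir hτ hgu, Finset.smul_sum, ← Finset.sum_add_distrib]
  refine Finset.sum_congr rfl fun l _ => ?_
  set z : ℂ := (g.val k i).2 w * ((g⁻¹).val j l).2 w with hz
  rw [archDerivE_add_dir hτ hgu, archDerivE_add_dir hτ hgu, archDerivE_smul_dir hτ hgu, archDerivE_smul_dir hτ hgu,
    archDerivE_smul_dir hτ hgu, archDerivE_smul_dir hτ hgu, ← map_mul, ← hz]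
  set Dc := archDerivE hcpt τ (Matrix.single k l ((0, Pi.single w 1) : mixedSpace K)) (τ (toArch hcpt g) u) with hDc
  set Dic := archDerivE hcpt τ (Matrix.single k l ((0, Pi.single w I) : mixedSpace K)) (τ (toArch hcpt g) u) with hDic
  have h3 : ((z.re : ℂ) - I * (z.im : ℂ)) = conj z := by
    apply Complex.ext <;> simp
  have h4 : ((z.im : ℂ) + I * (z.re : ℂ)) = conj z * I := by
    apply Complex.ext <;> simp
  have hL : ((z.re : ℂ) • Dc + (z.im : ℂ) • Dic) + I • (((-z.im : ℝ) : ℂ) • Dc + (z.re : ℂ) • Dic) =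
      ((z.re : ℂ) - I * (z.im : ℂ)) • Dc + ((z.im : ℂ) + I * (z.re : ℂ)) • Dic := by
    rw [Complex.ofReal_neg]
    module
  rw [hL, h3, h4]
  module

/-- **The holomorphic Casimir operator of a complex place commutes with `GL_n(K_∞)` on Gårding vectors.**
[cite: Knapp1986, Ch. VIII §3] -/
theorem apply_toArch_placeCasimirHol (hτ : τ.IsStronglyContinuous) (w : {w : InfinitePlace K // IsComplex w})
    (g : GL (Fin n) (mixedSpace K)) {v : E} (hv : v ∈ archGardingSpace hcpt τ) :
    τ (toArch hcpt g) (∑ i, ∑ j, archDerivHol hcpt τ w i j (archDerivHol hcpt τ w j i v)) =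
      ∑ i, ∑ j, archDerivHol hcpt τ w i j (archDerivHol hcpt τ w j i (τ (toArch hcpt g) v)) :=
  sum_sum_comp_comp_eq_of_transform (archGardingSpace hcpt τ) (fun i j u => archDerivHol hcpt τ w i j u)
    ((τ (toArch hcpt g) : E →L[ℂ] E) : E →ₗ[ℂ] E)
    (fun i j _ hu => archDerivHol_mem hτ w i j hu) (fun i j _ hu _ hu' => archDerivHol_add hτ w i j hu hu')
    (fun i j c _ hu => archDerivHol_smul hτ w i j c hu) (fun _ hu => apply_mem_archGardingSpace hτ (toArch hcpt g) hu)
    (fun k i => (g.val k i).2 w) (fun j l => ((g⁻¹).val j l).2 w) (sum_snd_mul_snd_inv_eq w g)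
    (fun i j _ hu => apply_toArch_archDerivHol hτ w g i j hu) hv

/-- **The antiholomorphic Casimir operator of a complex place commutes with `GL_n(K_∞)` on Gårding vectors.**
[cite: Knapp1986, Ch. VIII §3] -/
theorem apply_toArch_placeCasimirAnti (hτ : τ.IsStronglyContinuous) (w : {w : InfinitePlace K // IsComplex w})
    (g : GL (Fin n) (mixedSpace K)) {v : E} (hv : v ∈ archGardingSpace hcpt τ) :
    τ (toArch hcpt g) (∑ i, ∑ j, archDerivAnti hcpt τ w i j (archDerivAnti hcpt τ w j i v)) =
      ∑ i, ∑ j, archDerivAnti hcpt τ w i j (archDerivAnti hcpt τ w j i (τ (toArch hcpt g) v)) :=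
  sum_sum_comp_comp_eq_of_transform (archGardingSpace hcpt τ) (fun i j u => archDerivAnti hcpt τ w i j u)
    ((τ (toArch hcpt g) : E →L[ℂ] E) : E →ₗ[ℂ] E)
    (fun i j _ hu => archDerivAnti_mem hτ w i j hu) (fun i j _ hu _ hu' => archDerivAnti_add hτ w i j hu hu')
    (fun i j c _ hu => archDerivAnti_smul hτ w i j c hu) (fun _ hu => apply_mem_archGardingSpace hτ (toArch hcpt g) hu)
    (fun k i => conj ((g.val k i).2 w)) (fun j l => conj (((g⁻¹).val j l).2 w)) (sum_conj_snd_mul_conj_snd_inv_eq w g)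
    (fun i j _ hu => apply_toArch_archDerivAnti hτ w g i j hu) hv

end ComplexPlace

/-! ### 3. Formal adjoints for unitary `τ` -/

section Adjoint

variable {hcpt : isCompact_glFiniteIntegralLevel n K}
  {E : Type*} [NormedAddCommGroup E] [InnerProductSpace ℂ E] [CompleteSpace E]
  {τ : ContRepresentation ℂ (AutomorphyDatum.gl n K hcpt).arch.carrier E}

/-- **`⟪τ^{hol}(E_{ij}) v, u⟫ = -⟪v, τ^{anti}(E_{ij}) u⟫`** for Gårding `v, u` and unitary `τ` (the real
derivatives are skew-symmetric and `conj(i) = -i`). [folklore] -/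
theorem inner_archDerivHol_left (hτ : τ.IsStronglyContinuous) (hτu : τ.IsUnitary) (w : {w : InfinitePlace K // IsComplex w})
    (i j : Fin n) {v u : E} (hv : v ∈ archGardingSpace hcpt τ) (hu : u ∈ archGardingSpace hcpt τ) :
    ⟪archDerivHol hcpt τ w i j v, u⟫_ℂ = -⟪v, archDerivAnti hcpt τ w i j u⟫_ℂ := by
  unfold archDerivHol archDerivAnti
  rw [inner_sub_left, inner_smul_left, inner_add_right, inner_smul_right,
    inner_archDerivE_left hτ hτu hv hu, inner_archDerivE_left hτ hτu hv hu, Complex.conj_I]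
  ring

/-- **`⟪τ^{anti}(E_{ij}) v, u⟫ = -⟪v, τ^{hol}(E_{ij}) u⟫`** for Gårding `v, u` and unitary `τ`. [folklore] -/
theorem inner_archDerivAnti_left (hτ : τ.IsStronglyContinuous) (hτu : τ.IsUnitary) (w : {w : InfinitePlace K // IsComplex w})
    (i j : Fin n) {v u : E} (hv : v ∈ archGardingSpace hcpt τ) (hu : u ∈ archGardingSpace hcpt τ) :
    ⟪archDerivAnti hcpt τ w i j v, u⟫_ℂ = -⟪v, archDerivHol hcpt τ w i j u⟫_ℂ := by
  unfold archDerivHol archDerivAnti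
  rw [inner_add_left, inner_smul_left, inner_sub_right, inner_smul_right,
    inner_archDerivE_left hτ hτu hv hu, inner_archDerivE_left hτ hτu hv hu, Complex.conj_I]
  ring

/-- **Formal adjoint of the holomorphic Casimir**: `⟪C^{hol}_w v, u⟫ = ⟪v, C^{anti}_w u⟫` for Gårding
`v, u` and unitary `τ`. [folklore] -/
theorem inner_placeCasimirHol_left (hτ : τ.IsStronglyContinuous) (hτu : τ.IsUnitary)
    (w : {w : InfinitePlace K // IsComplex w}) {v u : E} (hv : v ∈ archGardingSpace hcpt τ) (hu : u ∈ archGardingSpace hcpt τ) :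
    ⟪∑ i, ∑ j, archDerivHol hcpt τ w i j (archDerivHol hcpt τ w j i v), u⟫_ℂ =
      ⟪v, ∑ i, ∑ j, archDerivAnti hcpt τ w i j (archDerivAnti hcpt τ w j i u)⟫_ℂ := by
  simp only [sum_inner, inner_sum]
  rw [Finset.sum_comm]
  refine Finset.sum_congr rfl fun a _ => Finset.sum_congr rfl fun b _ => ?_
  rw [inner_archDerivHol_left hτ hτu w b a (archDerivHol_mem hτ w a b hv) hu,
    inner_archDerivHol_left hτ hτu w a b hv (archDerivAnti_mem hτ w b a hu), neg_neg]

/-- **Formal adjoint of the antiholomorphic Casimir**: `⟪C^{anti}_w v, u⟫ = ⟪v, C^{hol}_w u⟫`. [folklore] -/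
theorem inner_placeCasimirAnti_left (hτ : τ.IsStronglyContinuous) (hτu : τ.IsUnitary)
    (w : {w : InfinitePlace K // IsComplex w}) {v u : E} (hv : v ∈ archGardingSpace hcpt τ) (hu : u ∈ archGardingSpace hcpt τ) :
    ⟪∑ i, ∑ j, archDerivAnti hcpt τ w i j (archDerivAnti hcpt τ w j i v), u⟫_ℂ =
      ⟪v, ∑ i, ∑ j, archDerivHol hcpt τ w i j (archDerivHol hcpt τ w j i u)⟫_ℂ := by
  simp only [sum_inner, inner_sum]
  rw [Finset.sum_comm]
  refine Finset.sum_congr rfl fun a _ => Finset.sum_congr rfl fun b _ => ?_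
  rw [inner_archDerivAnti_left hτ hτu w b a (archDerivAnti_mem hτ w a b hv) hu,
    inner_archDerivAnti_left hτ hτu w a b hv (archDerivHol_mem hτ w b a hu), neg_neg]

end Adjoint

end Literature.NumberTheory.Automorphic
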